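import Mathlib
import HarnessLib
import Summits.ValiantsHypothesis.ValiantsHypothesis.Theorems.LacunarySymmetroidMatrixDescartesProductPlusOneSplitSignedKWindow

/-!
# ValiantsHypothesis / LacunarySymmetroid — crux `MatrixDescartes` (stmt-ValiantsHypothesis-18050, V1),
# LINE (A) «product_plus_one»: every-`K` WINDOW LAW at a near-end coupling — the MIRROR (one exponent ABOVE the coupled letter)

Companion of ✓ `eulerNumeratorK_roots_Icc_le_one_of_upperSums_neg` (`…SplitSignedKWindow`): the every-`K` twin of the other half of the
`K = 3` type-β window law, ✓ `eulerNumeratorMiddle_roots_Icc_le_one_of_letterSumZero_neg` (`A₀ < 0 ⇒ ≤ 1 zero`).  Setting: rows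
`f_j = Σ_l C a_{jl} X^{d_l}` (ANY `K`, ANY support), coupled letter `l₀`, SPLIT-SIGNED rows (letters below the coupled exponent `≥ 0`, above
`≤ 0`), and the mirror near-end hypothesis: every exponent ABOVE `d_{l₀}` equals `d_{l₀} + h` for one gap `h > 0` (e.g. `l₀` = the
second-highest letter of a sorted support); some exponent lies below `d_{l₀}`.  Window `[u,v] ⊂ (0,∞)` on which every row keeps a constant sign.

* `neg_div_pow_strictMono_aux` — bookkeeping: `A(x) ≤ A(y) < 0`, `0 < x < y`, `n ≥ 1` ⇒ `A(x)/x^n < A(y)/y^n`;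
* ★★ `eulerNumeratorK_roots_Icc_le_one_of_lowerSums_neg` — THE MIRROR WINDOW LAW: if on `[u,v]` every LOWER letter-fraction sum is negative
  (`A_l(x) = Σ_j a_{jl}·x^{d_{l₀}}/f_j(x) < 0` for `d_l < d_{l₀}`; «the passed rows dominate every lower letter»), then `R_{l₀}` has AT MOST ONE
  zero in `[u,v]` — because `x^{−h}·Σ_j B_j/f_j = −Σ_{lower} g_l·A_l(x)/x^{g_l + h} + h·Σ_{upper} A_l(x)` is STRICTLY antitone there
  (`A_l/x^n` strictly isotone for a negative isotone `A_l`; upper `A_l` antitone by ✓ `inv_row_monotone_of_splitSigned`).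

HONEST FRAMING: a type-β window law for the every-`K` near-end interior coupling of the research stubs `stub_polyLaw` / `stub_eulerBoundK3`; the
type-α windows are the research content and are NOT touched; closes NO stub by name; NOT `OneChangeFloorK3`, `EulerBoundK3`, `ClassRowK3Linear`,
`PPOPolyLaw`, `ProductPlusOneMDR`, `MatrixDescartes`; `VP ≠ VNP` is NOT proved.  No definitions, no named facts, no sorry.

[folklore] Elementary monotonicity bookkeeping; no citation needed.
-/

set_option linter.dupNamespace false

namespace Summit.ValiantsHypothesis.ValiantsHypothesis.Theorems.LacunarySymmetroidMatrixDescartes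

namespace ProductPlusOne

open Polynomial Finset
open scoped BigOperators

/-- Bookkeeping: a NEGATIVE isotone quantity divided by a positive power is strictly isotone:
`A₁ ≤ A₂ < 0`, `0 < x < y`, `n ≠ 0` ⇒ `A₁/x^n < A₂/y^n`. [folklore] -/
theorem neg_div_pow_strictMono_aux {A₁ A₂ x y : ℝ} {n : ℕ} (hA : A₁ ≤ A₂) (hA₁ : A₁ < 0) (hx : 0 < x) (hxy : x < y)
    (hn : n ≠ 0) : A₁ / x ^ n < A₂ / y ^ n := by
  have hxn : 0 < x ^ n := pow_pos hx n
  have hyn : 0 < y ^ n := pow_pos (hx.trans hxy) n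
  have hpow : x ^ n < y ^ n := pow_lt_pow_left₀ hxy hx.le hn
  have step1 : A₁ / x ^ n < A₁ / y ^ n := by
    have hinv : (y ^ n)⁻¹ < (x ^ n)⁻¹ := (inv_lt_inv₀ hyn hxn).2 hpow
    rw [div_eq_mul_inv, div_eq_mul_inv]
    exact mul_lt_mul_of_neg_left hinv hA₁
  have step2 : A₁ / y ^ n ≤ A₂ / y ^ n := div_le_div_of_nonneg_right hA hyn.le
  exact step1.trans_le step2

/-- ★★ **EVERY-`K` MIRROR WINDOW LAW AT A NEAR-END COUPLING.**  Rows split-signed around `l₀`; every exponent above `d_{l₀}` equals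
`d_{l₀} + h` (`h > 0`); some exponent lies below `d_{l₀}`; a window `[u,v] ⊂ (0,∞)` on which every row keeps a constant sign; and on `[u,v]`
every LOWER letter-fraction sum is negative: `Σ_j a_{jl}·x^{d_{l₀}}/f_j(x) < 0` for all `l` with `d_l < d_{l₀}`.  Then the c-free Euler numerator
`R_{l₀}` has at most one zero in `[u,v]`. [this file's theorem] -/
theorem eulerNumeratorK_roots_Icc_le_one_of_lowerSums_neg {m K : ℕ} (d : Fin K → ℕ) (a : Fin m → Fin K → ℝ) (l₀ : Fin K)
    (hlow : ∀ j l, d l < d l₀ → 0 ≤ a j l) (hup : ∀ j l, d l₀ < d l → a j l ≤ 0)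
    (h : ℕ) (hh : 0 < h) (hgap : ∀ l, d l₀ < d l → d l = d l₀ + h) (hbot : ∃ l, d l < d l₀)
    {u v : ℝ} (hu : 0 < u)
    (hsign : ∀ j, (∀ x ∈ Set.Icc u v, 0 < (∑ l, C (a j l) * X ^ (d l) : ℝ[X]).eval x) ∨
      (∀ x ∈ Set.Icc u v, (∑ l, C (a j l) * X ^ (d l) : ℝ[X]).eval x < 0))
    (hA : ∀ x ∈ Set.Icc u v, ∀ l, d l < d l₀ →
      ∑ j, a j l * (x ^ (d l₀) / (∑ l', C (a j l') * X ^ (d l') : ℝ[X]).eval x) < 0) :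
    ((∑ j, (∑ l, C (a j l * ((d l : ℝ) - d l₀)) * X ^ (d l)) * ∏ i ∈ Finset.univ.erase j, (∑ l, C (a i l) * X ^ (d l))
        : ℝ[X]).roots.toFinset.filter (fun t => u ≤ t ∧ t ≤ v)).card ≤ 1 := by
  classical
  set f : Fin m → ℝ[X] := fun j => ∑ l, C (a j l) * X ^ (d l) with hf
  set T : Fin m → ℝ → ℝ := fun j x => x ^ (d l₀) / (f j).eval x with hT
  set A : Fin K → ℝ → ℝ := fun l x => ∑ j, a j l * T j x with hAdef
  -- the straightened Euler sum `Ψ(x) = Σ_l (d_l − d_{l₀}) · A_l(x) · x^{d_l} / x^{d_{l₀} + h}`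
  set Ψ : ℝ → ℝ := fun x => ∑ l, ((d l : ℝ) - d l₀) * (A l x * x ^ (d l) / x ^ (d l₀ + h)) with hΨ
  have hpole : ∀ x ∈ Set.Icc u v, ∀ j, (f j).eval x ≠ 0 := by
    intro x hx j
    rcases hsign j with hs | hs
    · exact (hs x hx).ne'
    · exact (hs x hx).ne
  -- (1) monotonicity of the letter-fraction sums
  have hTmono : ∀ j, MonotoneOn (T j) (Set.Icc u v) := fun j =>
    inv_row_monotone_of_splitSigned d (a j) l₀ (hlow j) (hup j) hu (hsign j)
  have hAlow : ∀ l, d l < d l₀ → MonotoneOn (A l) (Set.Icc u v) := by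
    intro l hl x hx y hy hxy
    exact Finset.sum_le_sum fun j _ => mul_le_mul_of_nonneg_left (hTmono j hx hy hxy) (hlow j l hl)
  have hAup : ∀ l, d l₀ < d l → AntitoneOn (A l) (Set.Icc u v) := by
    intro l hl x hx y hy hxy
    exact Finset.sum_le_sum fun j _ => mul_le_mul_of_nonpos_left (hTmono j hx hy hxy) (hup j l hl)
  -- (2) `Ψ` is strictly antitone on the window: termwise
  have hterm : ∀ x ∈ Set.Icc u v, ∀ y ∈ Set.Icc u v, x < y → ∀ l,
      ((d l : ℝ) - d l₀) * (A l y * y ^ (d l) / y ^ (d l₀ + h)) ≤ ((d l : ℝ) - d l₀) * (A l x * x ^ (d l) / x ^ (d l₀ + h)) := by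
    intro x hx y hy hxy l
    have hx0 : 0 < x := hu.trans_le hx.1
    have hy0 : 0 < y := hx0.trans hxy
    rcases lt_trichotomy (d l) (d l₀) with hl | hl | hl
    · -- lower letter: `A l < 0` isotone, divided by `x^{d l₀ + h − d l}`: strictly isotone; coefficient negative
      obtain ⟨n, hn⟩ : ∃ n, d l₀ + h = d l + n := ⟨d l₀ + h - d l, by omega⟩
      have hn0 : n ≠ 0 := by omega
      have hqx : A l x * x ^ (d l) / x ^ (d l₀ + h) = A l x / x ^ n := by
        rw [hn, pow_add, mul_comm (A l x) (x ^ d l), mul_div_mul_left _ _ (pow_ne_zero _ hx0.ne')]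
      have hqy : A l y * y ^ (d l) / y ^ (d l₀ + h) = A l y / y ^ n := by
        rw [hn, pow_add, mul_comm (A l y) (y ^ d l), mul_div_mul_left _ _ (pow_ne_zero _ hy0.ne')]
      rw [hqx, hqy]
      have hmono := neg_div_pow_strictMono_aux (hAlow l hl hx hy hxy.le) (hA x hx l hl) hx0 hxy hn0
      have hc : ((d l : ℝ) - d l₀) < 0 := by
        have : (d l : ℝ) < d l₀ := by exact_mod_cast hl
        linarith
      exact (mul_lt_mul_of_neg_left hmono hc).le
    · rw [hl, sub_self, zero_mul, zero_mul]
    · -- upper letter: exponent `d l₀ + h`, the ratio is `1`; `A l` antitone, coefficient positive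
      have hdl : d l = d l₀ + h := hgap l hl
      have hqx : A l x * x ^ (d l) / x ^ (d l₀ + h) = A l x := by
        rw [hdl, mul_div_assoc, div_self (pow_ne_zero _ hx0.ne'), mul_one]
      have hqy : A l y * y ^ (d l) / y ^ (d l₀ + h) = A l y := by
        rw [hdl, mul_div_assoc, div_self (pow_ne_zero _ hy0.ne'), mul_one]
      rw [hqx, hqy]
      have hc : 0 ≤ ((d l : ℝ) - d l₀) := by
        have : (d l₀ : ℝ) < d l := by exact_mod_cast hl
        linarith
      exact mul_le_mul_of_nonneg_left (hAup l hl hx hy hxy.le) hc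
  obtain ⟨lb, hlb⟩ := hbot
  have hstrict : ∀ x ∈ Set.Icc u v, ∀ y ∈ Set.Icc u v, x < y →
      ((d lb : ℝ) - d l₀) * (A lb y * y ^ (d lb) / y ^ (d l₀ + h)) < ((d lb : ℝ) - d l₀) * (A lb x * x ^ (d lb) / x ^ (d l₀ + h)) := by
    intro x hx y hy hxy
    have hx0 : 0 < x := hu.trans_le hx.1
    have hy0 : 0 < y := hx0.trans hxy
    obtain ⟨n, hn⟩ : ∃ n, d l₀ + h = d lb + n := ⟨d l₀ + h - d lb, by omega⟩
    have hn0 : n ≠ 0 := by omega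
    have hqx : A lb x * x ^ (d lb) / x ^ (d l₀ + h) = A lb x / x ^ n := by
      rw [hn, pow_add, mul_comm (A lb x) (x ^ d lb), mul_div_mul_left _ _ (pow_ne_zero _ hx0.ne')]
    have hqy : A lb y * y ^ (d lb) / y ^ (d l₀ + h) = A lb y / y ^ n := by
      rw [hn, pow_add, mul_comm (A lb y) (y ^ d lb), mul_div_mul_left _ _ (pow_ne_zero _ hy0.ne')]
    rw [hqx, hqy]
    have hmono := neg_div_pow_strictMono_aux (hAlow lb hlb hx hy hxy.le) (hA x hx lb hlb) hx0 hxy hn0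
    have hc : ((d lb : ℝ) - d l₀) < 0 := by
      have : (d lb : ℝ) < d l₀ := by exact_mod_cast hlb
      linarith
    exact mul_lt_mul_of_neg_left hmono hc
  have hΨanti : ∀ x ∈ Set.Icc u v, ∀ y ∈ Set.Icc u v, x < y → Ψ y < Ψ x := by
    intro x hx y hy hxy
    simp only [hΨ]
    rw [← Finset.add_sum_erase _ _ (Finset.mem_univ lb), ← Finset.add_sum_erase _ _ (Finset.mem_univ lb)]
    exact add_lt_add_of_lt_of_le (hstrict x hx y hy hxy) (Finset.sum_le_sum fun l _ => hterm x hx y hy hxy l)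
  -- (3) at a root `t` in the window, `Ψ t = 0`: `Ψ(x) = (Σ_j B_j(x)/f_j(x)) / x^h`
  have hletter : ∀ x ∈ Set.Icc u v,
      (∑ j, (∑ l, C (a j l * ((d l : ℝ) - d l₀)) * X ^ (d l) : ℝ[X]).eval x / (f j).eval x)
        = ∑ l, ((d l : ℝ) - d l₀) * ∑ j, a j l * x ^ (d l) / (f j).eval x := by
    intro x hx
    calc (∑ j, (∑ l, C (a j l * ((d l : ℝ) - d l₀)) * X ^ (d l) : ℝ[X]).eval x / (f j).eval x)
        = ∑ j, ∑ l, a j l * ((d l : ℝ) - d l₀) * x ^ (d l) / (f j).eval x := by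
          refine Finset.sum_congr rfl fun j _ => ?_
          rw [eulerLetter_eval, Finset.sum_div]
      _ = ∑ l, ∑ j, a j l * ((d l : ℝ) - d l₀) * x ^ (d l) / (f j).eval x := Finset.sum_comm
      _ = ∑ l, ((d l : ℝ) - d l₀) * ∑ j, a j l * x ^ (d l) / (f j).eval x := by
          refine Finset.sum_congr rfl fun l _ => ?_
          rw [Finset.mul_sum]
          refine Finset.sum_congr rfl fun j _ => ?_
          ring
  have hΨ_eq : ∀ x ∈ Set.Icc u v, Ψ x =
      (∑ j, (∑ l, C (a j l * ((d l : ℝ) - d l₀)) * X ^ (d l) : ℝ[X]).eval x / (f j).eval x) / x ^ h := by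
    intro x hx
    have hx0 : 0 < x := hu.trans_le hx.1
    rw [hletter x hx, Finset.sum_div]
    simp only [hΨ, hAdef, hT]
    refine Finset.sum_congr rfl fun l _ => ?_
    rw [mul_div_assoc ((d l : ℝ) - d l₀) (∑ j, a j l * x ^ (d l) / (f j).eval x) (x ^ h)]
    congr 1
    rw [Finset.sum_mul, Finset.sum_div, Finset.sum_div]
    refine Finset.sum_congr rfl fun j _ => ?_
    have hxh : x ^ h ≠ 0 := pow_ne_zero _ hx0.ne'
    have hx2 : x ^ (d l₀ + h) ≠ 0 := pow_ne_zero _ hx0.ne'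
    rw [div_eq_div_iff hx2 hxh, pow_add]
    ring
  have hroot : ∀ t, t ∈ ((∑ j, (∑ l, C (a j l * ((d l : ℝ) - d l₀)) * X ^ (d l)) *
      ∏ i ∈ Finset.univ.erase j, (∑ l, C (a i l) * X ^ (d l)) : ℝ[X]).roots.toFinset.filter (fun t => u ≤ t ∧ t ≤ v)) → Ψ t = 0 := by
    intro t ht
    rw [Finset.mem_filter, Multiset.mem_toFinset] at ht
    obtain ⟨hrt, htI⟩ := ht
    have htI' : t ∈ Set.Icc u v := htI
    have hev := (mem_roots (ne_zero_of_mem_roots hrt)).mp hrt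
    have hev' := hev
    rw [IsRoot.def, eulerNumeratorK_eval_eq_prod_mul_sum d a l₀ (hpole t htI')] at hev'
    have hP : (∏ i, (∑ l, C (a i l) * X ^ (d l) : ℝ[X]).eval t) ≠ 0 :=
      Finset.prod_ne_zero_iff.mpr fun i _ => hpole t htI' i
    have hsum := (mul_eq_zero.mp hev').resolve_left hP
    rw [hΨ_eq t htI', hsum, zero_div]
  -- (4) conclude
  rw [Finset.card_le_one]
  intro t₁ ht₁ t₂ ht₂
  have h1 := hroot t₁ ht₁
  have h2 := hroot t₂ ht₂
  have ht₁I : t₁ ∈ Set.Icc u v := (Finset.mem_filter.mp ht₁).2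
  have ht₂I : t₂ ∈ Set.Icc u v := (Finset.mem_filter.mp ht₂).2
  by_contra hne
  rcases lt_or_gt_of_ne hne with hlt | hlt
  · have := hΨanti t₁ ht₁I t₂ ht₂I hlt; linarith
  · have := hΨanti t₂ ht₂I t₁ ht₁I hlt; linarith

end ProductPlusOne

end Summit.ValiantsHypothesis.ValiantsHypothesis.Theorems.LacunarySymmetroidMatrixDescartes
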